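import Mathlib.Analysis.SpecialFunctions.Log.Basic
import Mathlib.Analysis.SpecialFunctions.Log.Base
import Mathlib.Data.Fintype.Fin
import Mathlib.Data.Nat.Log
import Mathlib.Order.Filter.AtTopBot.Basic
import Literature.Barriers.PneNP.NOFLogNBarrier
import HarnessLib

/-!
# Wide-block `MAJ ∘ MAJ` for two players: the `k = 2` fragment of `WideBlockMajMajConjecture`

`Literature.Barriers.PneNP.WideBlockMajMajConjecture` (file `NOFLogNBarrier.lean`) records, as an
OPEN conjecture (Hamoudi 2018, §4: "it is conjectured that the `log n` barrier can be broken by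
such functions for large `d`, two of the candidates being `MAJ ∘ MAJ_t` and `MAJ ∘ THR_t^s`"),
that for every `c, e`, all large `n` and every split `n = k · t` with `2 ≤ k ≤ (log₂ n)^c`
players, every valid deterministic simultaneous NOF protocol for `majMajNOF k n t` costs more than
`(log₂ n)^e` bits. For `k` between `log₂ n` and `polylog n` this is the `log n` barrier itself
(no technique is known); nothing of the sort is proved here.

This file proves the fragment that IS elementary — the boundary case `k = 2`, where the
number-on-forehead model degenerates to Yao's two-party model (player `1` sees exactly row `0`,
player `0` exactly row `1`) and the classical counting bound applies: player `1`'s message is a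
function of row `0` alone and must separate any two rows that some row `1` tells apart.

* `weightRow t u` — the row whose block `j` carries `u j` ones; `majMajNOF_two_weightRow` —
  on two such rows `MAJ ∘ MAJ_t` is `[n ≤ 2 · #{j : t ≤ u j + v j}]`.
* `majMajNOF_two_separates` — two rows with different block-weight vectors in `{0, …, t-1}ⁿ`
  are told apart by a suitable row `1` (block `j` of weight `t - w'_j`, `⌈n/2⌉ - 1` further
  blocks full, the rest empty).
* `pow_le_two_pow_cost_majMajNOF_two` — hence `t ^ n ≤ 2 ^ cost` for every valid simultaneous
  protocol computing `majMajNOF 2 n t`; `mul_log_le_cost_majMajNOF_two` — `n · ⌊log₂ t⌋ ≤ cost`.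
* `wideBlockMajMaj_two_players` — the conjecture's conclusion at `k = 2`: for every `e` and all
  large `n = 2t`, every such protocol costs more than `(log₂ n)^e`.

Nothing here bears on `k ≥ 3` players (where the players' views overlap and the counting
argument is void); the conjecture stays open and un-asserted.
-/

namespace Literature.Barriers.PneNP

open Finset Filter

/-! ### Rows with prescribed block weights -/

/-- The row of `n` blocks of width `t` whose block `j` consists of `u j` ones followed by zeros
(bit `(j, s)` is `1` iff `s < u j`). [folklore] -/
def weightRow {n : ℕ} (t : ℕ) (u : Fin n → ℕ) : Fin (n * t) → Bool :=
  fun p => decide (((finProdFinEquiv.symm p).2 : ℕ) < u (finProdFinEquiv.symm p).1)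

/-- Block `j` of `weightRow t u` has Hamming weight `u j` (if `u j ≤ t`). [folklore] -/
theorem hammingWt_weightRow {n t : ℕ} (u : Fin n → ℕ) (j : Fin n) (hu : u j ≤ t) :
    hammingWt (fun s : Fin t => weightRow t u (finProdFinEquiv (j, s))) = u j := by
  unfold hammingWt weightRow
  simp only [Equiv.symm_apply_apply, decide_eq_true_eq]
  rw [Fin.card_filter_val_lt, min_eq_right hu]

/-- The two-player NOF input with row `x` on player `0`'s forehead and row `y` on player `1`'s.
[folklore] -/
def twoRows {m : ℕ} (x y : Fin m → Bool) : NOFInput 2 m := fun i => if i = 0 then x else y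

/-- Row `0` of `twoRows x y`. [folklore] -/
@[simp] theorem twoRows_zero {m : ℕ} (x y : Fin m → Bool) : twoRows x y 0 = x := by
  simp [twoRows]

/-- Row `1` of `twoRows x y`. [folklore] -/
@[simp] theorem twoRows_one {m : ℕ} (x y : Fin m → Bool) : twoRows x y 1 = y := by
  simp [twoRows]

/-- Replacing row `1`. [folklore] -/
theorem update_twoRows_one {m : ℕ} (x y y' : Fin m → Bool) :
    Function.update (twoRows x y) 1 y' = twoRows x y' := by
  funext i
  by_cases h : i = 1
  · subst h; simp
  · have h0 : i = 0 := by omega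
    subst h0
    rw [Function.update_of_ne h, twoRows_zero, twoRows_zero]

/-- Replacing row `0`. [folklore] -/
theorem update_twoRows_zero {m : ℕ} (x x' y : Fin m → Bool) :
    Function.update (twoRows x y) 0 x' = twoRows x' y := by
  funext i
  by_cases h : i = 0
  · subst h; simp
  · have h1 : i = 1 := by omega
    subst h1
    rw [Function.update_of_ne h, twoRows_one, twoRows_one]

/-- **`MAJ ∘ MAJ_t` on two weight rows**: with block weights `u` (row `0`) and `v` (row `1`),
block `j` votes `1` iff `t ≤ u j + v j`, and the output is `[n ≤ 2 · #{j : t ≤ u j + v j}]`.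
[folklore] -/
theorem majMajNOF_two_weightRow {n t : ℕ} (u v : Fin n → ℕ) (hu : ∀ j, u j ≤ t)
    (hv : ∀ j, v j ≤ t) :
    majMajNOF 2 n t (twoRows (weightRow t u) (weightRow t v)) =
      decide (n ≤ 2 * (univ.filter fun j => t ≤ u j + v j).card) := by
  have hU : ∀ j, hammingWt (fun s : Fin t => weightRow t u (finProdFinEquiv (j, s))) = u j :=
    fun j => hammingWt_weightRow u j (hu j)
  have hV : ∀ j, hammingWt (fun s : Fin t => weightRow t v (finProdFinEquiv (j, s))) = v j :=
    fun j => hammingWt_weightRow v j (hv j)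
  have h2 : hammingWt (fun j => decide (2 * t ≤ 2 * (u j + v j))) =
      (univ.filter fun j => t ≤ u j + v j).card := by
    unfold hammingWt
    congr 1
    ext j
    simp only [mem_filter, mem_univ, true_and, decide_eq_true_eq]
    omega
  unfold majMajNOF composeBlockNOF maj
  simp only [majBlock, Fin.sum_univ_two, twoRows_zero, twoRows_one, hU, hV]
  rw [h2]

/-! ### Separation and counting -/

/-- The separating row `1`: block `j` of weight `t - a`, the blocks in `T` full, the rest empty.
[folklore] -/
def sepWeights {n : ℕ} (t : ℕ) (j : Fin n) (a : ℕ) (T : Finset (Fin n)) : Fin n → ℕ :=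
  fun i => if i = j then t - a else if i ∈ T then t else 0

/-- Against `sepWeights t j a T`, a row with block weights `w < t` has voting blocks exactly `T`,
plus `j` iff `a ≤ w j`. [folklore] -/
theorem filter_sepWeights {n t : ℕ} (w : Fin n → Fin t) (j : Fin n) (a : ℕ) (ha : a ≤ t)
    (T : Finset (Fin n)) (hjT : j ∉ T) :
    (univ.filter fun i => t ≤ (w i : ℕ) + sepWeights t j a T i) =
      if a ≤ w j then insert j T else T := by
  ext i
  simp only [mem_filter, mem_univ, true_and, sepWeights]
  by_cases hij : i = j
  · subst hij
    simp only [if_true]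
    have hi := (w i).isLt
    split_ifs with haw
    · simp only [mem_insert, true_or, iff_true]; omega
    · simp only [hjT, iff_false, not_le]; omega
  · simp only [if_neg hij]
    have hi := (w i).isLt
    by_cases hiT : i ∈ T
    · simp only [if_pos hiT]
      split_ifs
      · simp only [mem_insert, hij, hiT, or_true, iff_true]; omega
      · simp only [hiT, iff_true]; omega
    · simp only [if_neg hiT, add_zero]
      split_ifs
      · simp only [mem_insert, hij, hiT, or_false, iff_false, not_le]; omega
      · simp only [hiT, iff_false, not_le]; omega

/-- **Separation**: if `w j < w' j` (block weights below `t`), some row `1` makes `MAJ ∘ MAJ_t`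
false against `w` and true against `w'`. [folklore] -/
theorem majMajNOF_two_separates {n t : ℕ} (w w' : Fin n → Fin t) (j : Fin n)
    (hj : (w j : ℕ) < w' j) :
    ∃ v : Fin n → ℕ, (∀ i, v i ≤ t) ∧
      majMajNOF 2 n t (twoRows (weightRow t fun i => w i) (weightRow t v)) = false ∧
      majMajNOF 2 n t (twoRows (weightRow t fun i => w' i) (weightRow t v)) = true := by
  classical
  have hcard : (n - 1) / 2 ≤ (univ.erase j).card := by
    rw [Finset.card_erase_of_mem (mem_univ _), Finset.card_univ, Fintype.card_fin]; omega
  obtain ⟨T, hTsub, hTcard⟩ := Finset.exists_subset_card_eq hcard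
  have hjT : j ∉ T := fun h => (Finset.mem_erase.1 (hTsub h)).1 rfl
  have ha : (w' j : ℕ) ≤ t := (w' j).isLt.le
  have hn : 0 < n := j.pos
  refine ⟨sepWeights t j (w' j) T, ?_, ?_, ?_⟩
  · intro i
    unfold sepWeights
    split_ifs <;> omega
  · rw [majMajNOF_two_weightRow _ _ (fun i => (w i).isLt.le)
      (by intro i; unfold sepWeights; split_ifs <;> omega),
      filter_sepWeights w j (w' j) ha T hjT, if_neg (by omega), hTcard]
    simp only [decide_eq_false_iff_not, not_le]
    omega
  · rw [majMajNOF_two_weightRow _ _ (fun i => (w' i).isLt.le)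
      (by intro i; unfold sepWeights; split_ifs <;> omega),
      filter_sepWeights w' j (w' j) ha T hjT, if_pos le_rfl, Finset.card_insert_of_notMem hjT,
      hTcard]
    simp only [decide_eq_true_eq]
    omega

/-- **The two-party counting bound for wide-block `MAJ ∘ MAJ`.** Every valid simultaneous
two-player protocol computing `majMajNOF 2 n t` (blocks of `t` bits per player) satisfies
`t ^ n ≤ 2 ^ cost`: player `1`'s message depends on row `0` only and, by
`majMajNOF_two_separates`, is injective on the `t ^ n` rows `weightRow t w`, `w ∈ {0,…,t-1}ⁿ`.
[folklore] -/
theorem pow_le_two_pow_cost_majMajNOF_two {n t : ℕ} (S : SimultaneousProtocol 2 (n * t))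
    (hV : S.Valid) (he : ∀ X, S.eval X = majMajNOF 2 n t X) : t ^ n ≤ 2 ^ S.cost := by
  classical
  -- player 1's message does not see row 1, player 0's does not see row 0
  have hmsg1 : ∀ x y y' : Fin (n * t) → Bool, S.msg 1 (twoRows x y') = S.msg 1 (twoRows x y) := by
    intro x y y'
    rw [← update_twoRows_one x y y']
    exact hV 1 _ _
  have hmsg0 : ∀ x x' y : Fin (n * t) → Bool, S.msg 0 (twoRows x' y) = S.msg 0 (twoRows x y) := by
    intro x x' y
    rw [← update_twoRows_zero x x' y]
    exact hV 0 _ _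
  -- player 1's message as a function of the block-weight vector of row 0
  let Φ : (Fin n → Fin t) → (Fin (S.len 1) → Bool) :=
    fun w => S.msg 1 (twoRows (weightRow t fun i => w i) (weightRow t fun _ => 0))
  have key : ∀ w w' : Fin n → Fin t, Φ w = Φ w' → ∀ y,
      majMajNOF 2 n t (twoRows (weightRow t fun i => w i) y) =
        majMajNOF 2 n t (twoRows (weightRow t fun i => w' i) y) := by
    intro w w' hww y
    rw [← he, ← he]
    unfold SimultaneousProtocol.eval
    congr 1
    funext i
    by_cases hi : i = 0
    · subst hi
      exact hmsg0 _ _ _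
    · have h1 : i = 1 := by omega
      subst h1
      calc S.msg 1 (twoRows (weightRow t fun i => w i) y) = Φ w := hmsg1 _ _ _
        _ = Φ w' := hww
        _ = S.msg 1 (twoRows (weightRow t fun i => w' i) y) := (hmsg1 _ _ _).symm
  have hΦ : Function.Injective Φ := by
    intro w w' hww
    by_contra hne
    obtain ⟨j, hj⟩ := Function.ne_iff.1 hne
    have hj' : (w j : ℕ) ≠ w' j := fun h => hj (Fin.ext h)
    rcases lt_or_gt_of_ne hj' with hlt | hgt
    · obtain ⟨v, -, h1, h2⟩ := majMajNOF_two_separates w w' j hlt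
      rw [key w w' hww] at h1
      rw [h1] at h2
      exact Bool.false_ne_true h2
    · obtain ⟨v, -, h1, h2⟩ := majMajNOF_two_separates w' w j hgt
      rw [← key w w' hww] at h1
      rw [h1] at h2
      exact Bool.false_ne_true h2
  have hcard := Fintype.card_le_of_injective Φ hΦ
  simp only [Fintype.card_fun, Fintype.card_fin, Fintype.card_bool] at hcard
  refine hcard.trans (Nat.pow_le_pow_right (by norm_num) ?_)
  exact Finset.single_le_sum (f := S.len) (fun _ _ => Nat.zero_le _) (mem_univ (1 : Fin 2))

/-- **Corollary: `n · ⌊log₂ t⌋ ≤ cost`** for every valid simultaneous two-player protocol for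
`majMajNOF 2 n t`. [folklore] -/
theorem mul_log_le_cost_majMajNOF_two {n t : ℕ} (S : SimultaneousProtocol 2 (n * t))
    (hV : S.Valid) (he : ∀ X, S.eval X = majMajNOF 2 n t X) : n * Nat.log 2 t ≤ S.cost := by
  rcases Nat.eq_zero_or_pos t with rfl | ht
  · simp
  have h := pow_le_two_pow_cost_majMajNOF_two S hV he
  have h2 : 2 ^ (n * Nat.log 2 t) ≤ 2 ^ S.cost := by
    rw [mul_comm, pow_mul]
    exact (Nat.pow_le_pow_left (Nat.pow_log_le_self 2 ht.ne') n).trans h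
  exact (Nat.pow_le_pow_iff_right (by norm_num)).1 h2

/-! ### The conjecture's conclusion at `k = 2` -/

/-- `(log₂ n)^e < n` for all large `n` (from `(log x)^e = o(x)`). [folklore] -/
theorem eventually_logb_two_pow_lt (e : ℕ) : ∀ᶠ n : ℕ in atTop, Real.logb 2 n ^ e < n := by
  have hl2 : 0 < Real.log 2 ^ e := pow_pos (Real.log_pos one_lt_two) e
  have hlo := (Real.isLittleO_pow_log_id_atTop (n := e)).def (half_pos hl2)
  have hnat := tendsto_natCast_atTop_atTop.eventually hlo
  filter_upwards [hnat, eventually_ge_atTop 1] with n hn hn1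
  have hnpos : (0 : ℝ) < n := by exact_mod_cast hn1
  have hlog0 : 0 ≤ Real.log n := Real.log_nonneg (by exact_mod_cast hn1)
  rw [Real.norm_of_nonneg (pow_nonneg hlog0 e), id, Real.norm_of_nonneg hnpos.le] at hn
  rw [Real.logb, div_pow, div_lt_iff₀ hl2]
  calc Real.log n ^ e ≤ Real.log 2 ^ e / 2 * n := hn
    _ < n * Real.log 2 ^ e := by nlinarith

/-- **`WideBlockMajMajConjecture` holds at `k = 2` players.** For every exponent `e` there is
`n₀` such that for all `n ≥ n₀` and every split `n = 2 · t`, every valid simultaneous two-player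
protocol computing `majMajNOF 2 n t` costs more than `(log₂ n)^e` bits (indeed at least
`n ⌊log₂ (n/2)⌋`). This is the two-party boundary case only; for `3 ≤ k ≤ polylog n` players the
conjecture is open. [folklore] -/
theorem wideBlockMajMaj_two_players (e : ℕ) : ∃ n₀ : ℕ, ∀ n t : ℕ, n₀ ≤ n → n = 2 * t →
    ∀ S : SimultaneousProtocol 2 (n * t), S.Valid → (∀ X, S.eval X = majMajNOF 2 n t X) →
      Real.logb 2 n ^ e < (S.cost : ℝ) := by
  obtain ⟨n₀, hn₀⟩ := Filter.eventually_atTop.1 (eventually_logb_two_pow_lt e)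
  refine ⟨max n₀ 4, fun n t hn hnt S hV he => ?_⟩
  have ht : 2 ≤ t := by omega
  have h := pow_le_two_pow_cost_majMajNOF_two S hV he
  have hle : n ≤ S.cost := by
    have h2 : 2 ^ n ≤ 2 ^ S.cost := (Nat.pow_le_pow_left ht n).trans h
    exact (Nat.pow_le_pow_iff_right (by norm_num)).1 h2
  calc Real.logb 2 n ^ e < n := hn₀ n (le_of_max_le_left hn)
    _ ≤ S.cost := by exact_mod_cast hle

end Literature.Barriers.PneNP
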